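import Literature.NumberTheory.LFunctions.ZetaTruncationUniform
import Summits.RiemannHypothesis.RiemannHypothesis.Theorems.EtaLeadingQuarterWeakLockingLayerZeroSide

/-!
# The sharp eta trial vector at the low zeros (route EtaLeadingQuarter, item
`EtaLeadingSecondMoment`, stmt-RiemannHypothesis-21791) — regime (Z2) of BRIEF-L18-K1

For `T_M(γ) = −1 + ∑_{m=2}^{M} (−1)^m m^{−1/2} m^{iγ} = ∑_{m=1}^{M} (−1)^m m^{−s̄}`, `s̄ = 1/2 − iγ`:

* `altSum_eq` — the alternating partial sum through the ordinary ones,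
  `∑_{m≤M} (−1)^m m^{−s} = 2^{1−s} ∑_{n≤⌊M/2⌋} n^{−s} − ∑_{m≤M} m^{−s}` (even/odd split);
* `trialVector_eq` — the statement's vector is `∑_{m≤M} (−1)^m m^{−(1/2 − iγ)}`;
* `norm_altSum_le_of_zero` — at a ZERO `s` of `ζ` on the critical line with `|Im s| ≤ 4⌊M/2⌋`:
  `‖∑_{m≤M} (−1)^m m^{−s}‖ ≤ 24 M^{−1/2}` — by the tree's uniform truncation formula (4.11.1)
  (`norm_zeta_sub_sum_add_le_uniform`: `ζ(s) = ∑_{n≤X} n^{−s} − X^{1−s}/(1−s) + O(X^{−σ})` for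
  `|t| ≤ 4X`) at `X = M` and `X = ⌊M/2⌋`: the `ζ(s)` terms vanish and the two main terms
  `2^{1−s}⌊M/2⌋^{1−s}`, `M^{1−s}` cancel up to `|1−s| (M−1)^{−1/2}` (the arithmetic shadow of the
  missing pole of `η`);
* `smallHeight_le` — hence, under RH, the zeros with `|γ| ≤ 4⌊M/2⌋` contribute
  `M · ∑ m γ^{-2} ‖T_M(γ)‖² ≤ 576 ∑_ρ m/γ² = O(1)` to the second moment of `EtaLeadingSecondMoment`.

RH enters only through "`1/2 − iγ` is a zero". Nothing here bears on the truth of RH.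
-/

noncomputable section

open Complex MeasureTheory Set Filter Finset intervalIntegral
open scoped Real Topology ComplexConjugate

set_option linter.dupNamespace false  -- the mandated namespace repeats `RiemannHypothesis`

namespace Summit.RiemannHypothesis.RiemannHypothesis.Theorems.EtaLeadingQuarter.EtaTrial

open Literature.NumberTheory.LFunctions NicolasJExplicit SchoenfeldBound ZetaZeroTails
open Summit.RiemannHypothesis.RiemannHypothesis.Theorems.EtaLeadingQuarter.ZeroSide

/-! ## The alternating partial sums -/

/-- Even/odd split: `∑_{m≤M} (−1)^m m^{−s} = 2^{1−s} ∑_{n≤⌊M/2⌋} n^{−s} − ∑_{m≤M} m^{−s}`. [folklore] -/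
theorem altSum_eq (s : ℂ) (M : ℕ) :
    ∑ m ∈ Finset.Icc 1 M, (-1 : ℂ) ^ m * (m : ℂ) ^ (-s) =
      (2 : ℂ) ^ (1 - s) * ∑ n ∈ Finset.Icc 1 (M / 2), (n : ℂ) ^ (-s) -
        ∑ m ∈ Finset.Icc 1 M, (m : ℂ) ^ (-s) := by
  classical
  -- even part reindexed
  have himage : (Finset.Icc 1 M).filter (fun m ↦ Even m) =
      (Finset.Icc 1 (M / 2)).image (fun n ↦ 2 * n) := by
    ext m
    simp only [Finset.mem_filter, Finset.mem_Icc, Finset.mem_image]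
    constructor
    · rintro ⟨⟨h1, h2⟩, ⟨r, hr⟩⟩
      exact ⟨r, ⟨by omega, by omega⟩, by omega⟩
    · rintro ⟨n, ⟨h1, h2⟩, rfl⟩
      exact ⟨⟨by omega, by omega⟩, ⟨n, by ring⟩⟩
  have hinj : Set.InjOn (fun n : ℕ ↦ 2 * n) ↑(Finset.Icc 1 (M / 2)) := fun a _ b _ h ↦ by
    simpa using h
  have hE : ∑ m ∈ (Finset.Icc 1 M).filter (fun m ↦ Even m), (m : ℂ) ^ (-s) =
      (2 : ℂ) ^ (-s) * ∑ n ∈ Finset.Icc 1 (M / 2), (n : ℂ) ^ (-s) := by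
    rw [himage, Finset.sum_image hinj, Finset.mul_sum]
    refine Finset.sum_congr rfl fun n _ ↦ ?_
    have e : ((2 * n : ℕ) : ℂ) = ((2 : ℝ) : ℂ) * ((n : ℝ) : ℂ) := by push_cast; ring
    rw [e, Complex.mul_cpow_ofReal_nonneg (by norm_num) (Nat.cast_nonneg n)]
    push_cast
    ring
  -- the alternating sum as (even) − (odd), the full sum as (even) + (odd)
  have hsplitA : ∑ m ∈ Finset.Icc 1 M, (-1 : ℂ) ^ m * (m : ℂ) ^ (-s) =
      ∑ m ∈ (Finset.Icc 1 M).filter (fun m ↦ Even m), (m : ℂ) ^ (-s) -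
        ∑ m ∈ (Finset.Icc 1 M).filter (fun m ↦ ¬Even m), (m : ℂ) ^ (-s) := by
    rw [← Finset.sum_filter_add_sum_filter_not (Finset.Icc 1 M) (fun m ↦ Even m), sub_eq_add_neg,
      ← Finset.sum_neg_distrib]
    congr 1
    · refine Finset.sum_congr rfl fun m hm ↦ ?_
      rw [(Finset.mem_filter.1 hm).2.neg_one_pow, one_mul]
    · refine Finset.sum_congr rfl fun m hm ↦ ?_
      rw [(Nat.not_even_iff_odd.1 (Finset.mem_filter.1 hm).2).neg_one_pow]
      ring
  have hsplitF : ∑ m ∈ Finset.Icc 1 M, (m : ℂ) ^ (-s) =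
      ∑ m ∈ (Finset.Icc 1 M).filter (fun m ↦ Even m), (m : ℂ) ^ (-s) +
        ∑ m ∈ (Finset.Icc 1 M).filter (fun m ↦ ¬Even m), (m : ℂ) ^ (-s) :=
    (Finset.sum_filter_add_sum_filter_not _ _ _).symm
  have h2 : (2 : ℂ) ^ (1 - s) = 2 * (2 : ℂ) ^ (-s) := by
    rw [sub_eq_add_neg, Complex.cpow_add _ _ (by norm_num), Complex.cpow_one]
  rw [hsplitA, hsplitF, h2, mul_assoc, ← hE]
  ring

/-- The statement's vector: for `M ≥ 1`,
`−1 + ∑_{m=2}^{M} (−1)^m m^{−1/2} m^{iγ} = ∑_{m=1}^{M} (−1)^m m^{−(1/2 − iγ)}`. [folklore] -/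
theorem trialVector_eq {M : ℕ} (hM : 1 ≤ M) (γ : ℝ) :
    -1 + ∑ m ∈ Finset.Icc 2 M, ((((-1 : ℝ) ^ m * (m : ℝ) ^ (-(1 / 2 : ℝ))) : ℝ) : ℂ) *
        (m : ℂ) ^ (((γ : ℝ) : ℂ) * I) =
      ∑ m ∈ Finset.Icc 1 M, (-1 : ℂ) ^ m * (m : ℂ) ^ (-(1 / 2 - (γ : ℂ) * I)) := by
  rw [← Finset.insert_Icc_add_one_left_eq_Icc hM, Finset.sum_insert (by simp)]
  simp only [pow_one, Nat.cast_one, Complex.one_cpow, mul_one]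
  congr 1
  refine Finset.sum_congr rfl fun m hm ↦ ?_
  rw [Finset.mem_Icc] at hm
  have hm0 : (m : ℂ) ≠ 0 := Nat.cast_ne_zero.2 (by omega)
  have e1 : -(1 / 2 - (γ : ℂ) * I) = (((-(1 / 2 : ℝ)) : ℝ) : ℂ) + (γ : ℂ) * I := by push_cast; ring
  rw [e1, Complex.cpow_add _ _ hm0]
  have e2 : ((m : ℂ)) ^ ((((-(1 / 2 : ℝ)) : ℝ) : ℂ)) = (((m : ℝ) ^ (-(1 / 2 : ℝ)) : ℝ) : ℂ) := by
    rw [Complex.ofReal_cpow (Nat.cast_nonneg m)]; push_cast; rfl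
  rw [e2]
  push_cast
  ring

/-! ## At a zero: the two truncation formulas cancel -/

/-- `‖(2K)^{1−s} − M^{1−s}‖ ≤ ‖1 − s‖ (2K)^{−1/2}` for `M ∈ {2K, 2K+1}`, `Re s = 1/2`, `K ≥ 1`
(`x ↦ x^{1−s}` has derivative `(1−s)x^{−s}`). [folklore] -/
theorem norm_cpow_sub_cpow_le {s : ℂ} (hre : s.re = 1 / 2) (hs1 : s ≠ 1) {K M : ℕ} (hK : 1 ≤ K)
    (hM1 : 2 * K ≤ M) (hM2 : M ≤ 2 * K + 1) :
    ‖((2 * K : ℕ) : ℂ) ^ (1 - s) - (M : ℂ) ^ (1 - s)‖ ≤ ‖1 - s‖ * (2 * K : ℝ) ^ (-(1 / 2 : ℝ)) := by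
  have hK0 : (0 : ℝ) < 2 * K := by positivity
  have hKM : (2 * K : ℝ) ≤ M := by exact_mod_cast hM1
  have hMK : (M : ℝ) ≤ 2 * K + 1 := by exact_mod_cast hM2
  have h1s : 1 - s ≠ 0 := sub_ne_zero.2 (Ne.symm hs1)
  -- `∫_{2K}^{M} x^{-s} dx = (M^{1-s} - (2K)^{1-s})/(1-s)`
  have hint : ∫ x : ℝ in (2 * K : ℝ)..M, (x : ℂ) ^ (-s) =
      ((M : ℂ) ^ (-s + 1) - ((2 * K : ℝ) : ℂ) ^ (-s + 1)) / (-s + 1) := by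
    refine integral_cpow (Or.inr ⟨?_, ?_⟩)
    · intro h; apply hs1
      have := congrArg (fun z ↦ -z) h; simp at this; exact this
    · rw [Set.uIcc_of_le hKM]; intro h; exact absurd h.1 (not_le.2 hK0)
  have e1 : -s + 1 = 1 - s := by ring
  rw [e1] at hint
  have hnorm : ‖∫ x : ℝ in (2 * K : ℝ)..M, (x : ℂ) ^ (-s)‖ ≤ (2 * K : ℝ) ^ (-(1 / 2 : ℝ)) * |(M : ℝ) - 2 * K| := by
    refine intervalIntegral.norm_integral_le_of_norm_le_const fun x hx ↦ ?_
    rw [Set.uIoc_of_le hKM] at hx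
    have hx0 : 0 < x := hK0.trans hx.1
    rw [Complex.norm_cpow_eq_rpow_re_of_pos hx0, Complex.neg_re, hre]
    exact Real.rpow_le_rpow_of_nonpos hK0 hx.1.le (by norm_num)
  have habs : |(M : ℝ) - 2 * K| ≤ 1 := by rw [abs_le]; constructor <;> linarith
  have e2 : ((2 * K : ℕ) : ℂ) ^ (1 - s) - (M : ℂ) ^ (1 - s) =
      -((1 - s) * ∫ x : ℝ in (2 * K : ℝ)..M, (x : ℂ) ^ (-s)) := by
    rw [hint, mul_div_cancel₀ _ h1s]; push_cast; ring
  rw [e2, norm_neg, norm_mul]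
  calc ‖1 - s‖ * ‖∫ x : ℝ in (2 * K : ℝ)..M, (x : ℂ) ^ (-s)‖
      ≤ ‖1 - s‖ * ((2 * K : ℝ) ^ (-(1 / 2 : ℝ)) * |(M : ℝ) - 2 * K|) :=
        mul_le_mul_of_nonneg_left hnorm (norm_nonneg _)
    _ ≤ ‖1 - s‖ * ((2 * K : ℝ) ^ (-(1 / 2 : ℝ)) * 1) := by gcongr
    _ = _ := by ring

/-- **`‖∑_{m≤M} (−1)^m m^{−s}‖ ≤ 24 M^{−1/2}` at a critical-line ZERO `s` of `ζ` with `|Im s| ≤ 4⌊M/2⌋`**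
(`M ≥ 3`). [folklore] -/
theorem norm_altSum_le_of_zero {s : ℂ} (hre : s.re = 1 / 2) (hζ : riemannZeta s = 0)
    (ht : s.im ≠ 0) {M : ℕ} (hM : 3 ≤ M) (htM : |s.im| ≤ 4 * ((M / 2 : ℕ) : ℝ)) :
    ‖∑ m ∈ Finset.Icc 1 M, (-1 : ℂ) ^ m * (m : ℂ) ^ (-s)‖ ≤ 24 * (M : ℝ) ^ (-(1 / 2 : ℝ)) := by
  set K : ℕ := M / 2 with hK
  have hK1 : 1 ≤ K := by omega
  have hM1 : 1 ≤ M := by omega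
  have hKM1 : 2 * K ≤ M := by omega
  have hKM2 : M ≤ 2 * K + 1 := by omega
  have h3K : M ≤ 3 * K := by omega
  have hs1 : s ≠ 1 := by intro h; rw [h] at ht; simp at ht
  have h1s : 1 - s ≠ 0 := sub_ne_zero.2 (Ne.symm hs1)
  have hσ : 0 < s.re := by rw [hre]; norm_num
  have hσ2 : s.re ≤ 2 := by rw [hre]; norm_num
  have htM' : |s.im| ≤ 4 * (M : ℝ) := htM.trans (by gcongr; exact_mod_cast Nat.div_le_self M 2)
  -- (4.11.1) at `M` and at `K`, with `ζ(s) = 0`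
  have hRM := norm_zeta_sub_sum_add_le_uniform hσ hσ2 ht hM1 htM'
  have hRK := norm_zeta_sub_sum_add_le_uniform hσ hσ2 ht hK1 htM
  rw [hζ, zero_sub, hre] at hRM hRK
  -- the identity
  rw [altSum_eq]
  set ZM : ℂ := ∑ m ∈ Finset.Icc 1 M, (m : ℂ) ^ (-s) with hZM
  set ZK : ℂ := ∑ n ∈ Finset.Icc 1 K, (n : ℂ) ^ (-s) with hZK
  set RM : ℂ := -ZM + (M : ℂ) ^ (1 - s) / (1 - s) with hRMdef
  set RK : ℂ := -ZK + (K : ℂ) ^ (1 - s) / (1 - s) with hRKdef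
  have eM : ZM = (M : ℂ) ^ (1 - s) / (1 - s) - RM := by rw [hRMdef]; ring
  have eK : ZK = (K : ℂ) ^ (1 - s) / (1 - s) - RK := by rw [hRKdef]; ring
  -- `2^{1-s} K^{1-s} = (2K)^{1-s}`
  have e2K : (2 : ℂ) ^ (1 - s) * (K : ℂ) ^ (1 - s) = ((2 * K : ℕ) : ℂ) ^ (1 - s) := by
    have e : ((2 * K : ℕ) : ℂ) = ((2 : ℝ) : ℂ) * ((K : ℝ) : ℂ) := by push_cast; ring
    rw [e, Complex.mul_cpow_ofReal_nonneg (by norm_num) (Nat.cast_nonneg K)]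
    push_cast; ring
  have hmain := norm_cpow_sub_cpow_le hre hs1 hK1 hKM1 hKM2
  have key : (2 : ℂ) ^ (1 - s) * ZK - ZM =
      (((2 * K : ℕ) : ℂ) ^ (1 - s) - (M : ℂ) ^ (1 - s)) / (1 - s) - (2 : ℂ) ^ (1 - s) * RK + RM := by
    rw [eM, eK, mul_sub, mul_div_assoc', e2K]; ring
  rw [key]
  -- norms
  have hn2 : ‖(2 : ℂ) ^ (1 - s)‖ = Real.sqrt 2 := by
    rw [show (2 : ℂ) = ((2 : ℝ) : ℂ) by norm_num, Complex.norm_cpow_eq_rpow_re_of_pos (by norm_num),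
      Complex.sub_re, Complex.one_re, hre, Real.sqrt_eq_rpow]
    norm_num
  have hsqrt2 : Real.sqrt 2 ≤ 3 / 2 := by
    rw [show (3 / 2 : ℝ) = Real.sqrt ((3 / 2) ^ 2) by rw [Real.sqrt_sq]; norm_num]
    exact Real.sqrt_le_sqrt (by norm_num)
  have hT1 : ‖(((2 * K : ℕ) : ℂ) ^ (1 - s) - (M : ℂ) ^ (1 - s)) / (1 - s)‖ ≤ (2 * K : ℝ) ^ (-(1 / 2 : ℝ)) := by
    rw [norm_div, div_le_iff₀ (norm_pos_iff.2 h1s)]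
    linarith [hmain]
  have hT2 : ‖(2 : ℂ) ^ (1 - s) * RK‖ ≤ 3 / 2 * (6 * (K : ℝ) ^ (-(1 / 2 : ℝ))) := by
    rw [norm_mul, hn2]
    exact mul_le_mul hsqrt2 hRK (norm_nonneg _) (by norm_num)
  -- compare `K^{-1/2}`, `(2K)^{-1/2}` with `M^{-1/2}`
  have hK0 : (0 : ℝ) < K := by exact_mod_cast hK1
  have hM0 : (0 : ℝ) < M := by exact_mod_cast hM1
  have h3K' : (M : ℝ) ≤ 3 * K := by exact_mod_cast h3K
  have hKpow : (K : ℝ) ^ (-(1 / 2 : ℝ)) ≤ Real.sqrt 3 * (M : ℝ) ^ (-(1 / 2 : ℝ)) := by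
    rw [Real.rpow_neg hK0.le, Real.rpow_neg hM0.le, ← Real.sqrt_eq_rpow, ← Real.sqrt_eq_rpow,
      ← Real.sqrt_inv, ← Real.sqrt_inv, ← Real.sqrt_mul (by norm_num)]
    exact Real.sqrt_le_sqrt (by rw [le_mul_inv_iff₀ hM0, mul_comm, ← div_eq_mul_inv, div_le_iff₀ hK0]; linarith)
  have h2Kpow : (2 * K : ℝ) ^ (-(1 / 2 : ℝ)) ≤ (K : ℝ) ^ (-(1 / 2 : ℝ)) :=
    Real.rpow_le_rpow_of_nonpos hK0 (by linarith) (by norm_num)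
  have hsqrt3 : Real.sqrt 3 ≤ 7 / 4 := by
    rw [show (7 / 4 : ℝ) = Real.sqrt ((7 / 4) ^ 2) by rw [Real.sqrt_sq]; norm_num]
    exact Real.sqrt_le_sqrt (by norm_num)
  have hMpow0 : 0 ≤ (M : ℝ) ^ (-(1 / 2 : ℝ)) := by positivity
  calc ‖(((2 * K : ℕ) : ℂ) ^ (1 - s) - (M : ℂ) ^ (1 - s)) / (1 - s) - (2 : ℂ) ^ (1 - s) * RK + RM‖
      ≤ ‖(((2 * K : ℕ) : ℂ) ^ (1 - s) - (M : ℂ) ^ (1 - s)) / (1 - s)‖ + ‖(2 : ℂ) ^ (1 - s) * RK‖ + ‖RM‖ := by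
        have := norm_sub_le ((((2 * K : ℕ) : ℂ) ^ (1 - s) - (M : ℂ) ^ (1 - s)) / (1 - s)) ((2 : ℂ) ^ (1 - s) * RK)
        have := norm_add_le ((((2 * K : ℕ) : ℂ) ^ (1 - s) - (M : ℂ) ^ (1 - s)) / (1 - s) - (2 : ℂ) ^ (1 - s) * RK) RM
        linarith
    _ ≤ (K : ℝ) ^ (-(1 / 2 : ℝ)) + 3 / 2 * (6 * (K : ℝ) ^ (-(1 / 2 : ℝ))) + 6 * (M : ℝ) ^ (-(1 / 2 : ℝ)) := by
        linarith [hT1, hT2, hRM, h2Kpow]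
    _ ≤ 24 * (M : ℝ) ^ (-(1 / 2 : ℝ)) := by nlinarith [hKpow, hsqrt3, hMpow0]

/-! ## The low zeros in the second moment -/

/-- **Regime (Z2).** Under RH, for `M ≥ 3`, the zeros with `|γ| ≤ 4⌊M/2⌋` contribute at most
`576 ∑'_ρ m(ρ)/γ²` to `M · ∑_ρ m γ^{-2} ‖−1 + ∑_{m=2}^{M} (−1)^m m^{−1/2} m^{iγ}‖²`. [folklore] -/
theorem smallHeight_le (hRH : RiemannHypothesis) {M : ℕ} (hM : 3 ≤ M) :
    (M : ℝ) * ∑ ρ ∈ zerosUpTo (4 * ((M / 2 : ℕ) : ℝ)),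
        (riemannZetaZeroOrder (ρ : ℂ) : ℝ) / (ρ : ℂ).im ^ 2 *
          ‖-1 + ∑ m ∈ Finset.Icc 2 M, ((((-1 : ℝ) ^ m * (m : ℝ) ^ (-(1 / 2 : ℝ))) : ℝ) : ℂ) *
            (m : ℂ) ^ ((((ρ : ℂ).im : ℝ) : ℂ) * I)‖ ^ 2 ≤
      576 * ∑' ρ : Zeros, (riemannZetaZeroOrder (ρ : ℂ) : ℝ) / (ρ : ℂ).im ^ 2 := by
  have hM1 : 1 ≤ M := by omega
  have hM0 : (0 : ℝ) < M := by exact_mod_cast hM1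
  -- pointwise bound at each low zero
  have hpt : ∀ ρ ∈ zerosUpTo (4 * ((M / 2 : ℕ) : ℝ)),
      ‖-1 + ∑ m ∈ Finset.Icc 2 M, ((((-1 : ℝ) ^ m * (m : ℝ) ^ (-(1 / 2 : ℝ))) : ℝ) : ℂ) *
          (m : ℂ) ^ ((((ρ : ℂ).im : ℝ) : ℂ) * I)‖ ^ 2 ≤ 576 * (M : ℝ)⁻¹ := by
    intro ρ hρ
    rw [trialVector_eq hM1]
    -- `s = conj ρ = 1/2 - iγ` is a zero
    set s : ℂ := conj (ρ : ℂ) with hs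
    have hmem : s ∈ ZetaZeros.riemannZetaNontrivialZeros := ZetaZeros.riemannZetaNontrivialZeros.conj_mem ρ.2
    have hζ : riemannZeta s = 0 := ZetaZeros.riemannZetaNontrivialZeros.zeta_eq_zero hmem
    have hre : s.re = 1 / 2 := re_eq_half_of_RH hRH hmem
    have him : s.im = -(ρ : ℂ).im := by rw [hs, Complex.conj_im]
    have ht : s.im ≠ 0 := by rw [him, neg_ne_zero]; exact ZetaZeros.riemannZetaNontrivialZeros.im_ne_zero ρ.2
    have htM : |s.im| ≤ 4 * ((M / 2 : ℕ) : ℝ) := by rw [him, abs_neg]; exact mem_zerosUpTo.1 hρ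
    have es : (1 / 2 - (((ρ : ℂ).im : ℝ) : ℂ) * I) = s := by
      apply Complex.ext
      · simp [hre]
      · simp [him]
    rw [es]
    have h := norm_altSum_le_of_zero hre hζ ht hM htM
    have h0 := norm_nonneg (∑ m ∈ Finset.Icc 1 M, (-1 : ℂ) ^ m * (m : ℂ) ^ (-s))
    have e : (24 * (M : ℝ) ^ (-(1 / 2 : ℝ))) ^ 2 = 576 * (M : ℝ)⁻¹ := by
      have h2 : ((M : ℝ) ^ (-(1 / 2 : ℝ))) ^ 2 = (M : ℝ)⁻¹ := by
        rw [← Real.rpow_two, ← Real.rpow_mul hM0.le]; norm_num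
        exact Real.rpow_neg_one (M : ℝ)
      rw [mul_pow, h2]; norm_num
    rw [← e]
    exact pow_le_pow_left₀ h0 h 2
  calc (M : ℝ) * ∑ ρ ∈ zerosUpTo (4 * ((M / 2 : ℕ) : ℝ)),
        (riemannZetaZeroOrder (ρ : ℂ) : ℝ) / (ρ : ℂ).im ^ 2 *
          ‖-1 + ∑ m ∈ Finset.Icc 2 M, ((((-1 : ℝ) ^ m * (m : ℝ) ^ (-(1 / 2 : ℝ))) : ℝ) : ℂ) *
            (m : ℂ) ^ ((((ρ : ℂ).im : ℝ) : ℂ) * I)‖ ^ 2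
      ≤ (M : ℝ) * ∑ ρ ∈ zerosUpTo (4 * ((M / 2 : ℕ) : ℝ)),
          (riemannZetaZeroOrder (ρ : ℂ) : ℝ) / (ρ : ℂ).im ^ 2 * (576 * (M : ℝ)⁻¹) := by
        refine mul_le_mul_of_nonneg_left (Finset.sum_le_sum fun ρ hρ ↦ ?_) hM0.le
        exact mul_le_mul_of_nonneg_left (hpt ρ hρ) (zeroOrder_div_im_sq_nonneg ρ)
    _ = 576 * ∑ ρ ∈ zerosUpTo (4 * ((M / 2 : ℕ) : ℝ)), (riemannZetaZeroOrder (ρ : ℂ) : ℝ) / (ρ : ℂ).im ^ 2 := by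
        rw [← Finset.sum_mul]; field_simp
    _ ≤ 576 * ∑' ρ : Zeros, (riemannZetaZeroOrder (ρ : ℂ) : ℝ) / (ρ : ℂ).im ^ 2 := by
        refine mul_le_mul_of_nonneg_left ?_ (by norm_num)
        exact LittlewoodAverage.summable_zeroOrder_div_im_sq.sum_le_tsum _ fun ρ _ ↦ zeroOrder_div_im_sq_nonneg ρ

end Summit.RiemannHypothesis.RiemannHypothesis.Theorems.EtaLeadingQuarter.EtaTrial

end
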